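import Literature.NumberTheory.GaloisCohomology.Howard2004.RelaxedSelmerIsotropyProofs
import Literature.NumberTheory.GaloisCohomology.Howard2004.EigenSelmerDichotomyProofs
import Literature.NumberTheory.GaloisCohomology.Howard2004.SelfOrthogonalOfIsotropicCountProofs
import Literature.NumberTheory.GaloisCohomology.Howard2004.InertLocalTauProofs
import Literature.NumberTheory.GaloisCohomology.SelmerStructureModifyOnePlaceProofs
import Literature.NumberTheory.GaloisCohomology.Howard2004.ResidualTateDualBijectiveProofs
import Literature.NumberTheory.GaloisCohomology.Howard2004.ResidualSelfOrthogonalProofs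
import Literature.NumberTheory.GaloisCohomology.Howard2004.RelaxedSelmerLagrangianCountProofs
import Literature.NumberTheory.GaloisCohomology.Howard2004.TransverseIsotropyProofs
import Literature.NumberTheory.GaloisCohomology.Howard2004.DVRSettingLevelTrivialityProofs
import Literature.NumberTheory.GaloisCohomology.Howard2004.DVRSettingEngineLocalInputsProofs
import Literature.NumberTheory.GaloisCohomology.Howard2004.ResidualSelmerEigenpartsProofs
import Literature.NumberTheory.GaloisCohomology.Howard2004.RingClassConjugationStableProofs
import Literature.NumberTheory.GaloisCohomology.Howard2004.InertLocalPairingSymmetricProofs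
import Literature.NumberTheory.GaloisCohomology.Howard2004.InertTransverseDecompositionOfUnitsProofs
import HarnessLib

/-!
# Howard 2004, Lemma 1.5.3 / 1.5.6 on a `DVRSetting`: `H¹(K_q, T̄)⁺ ⊥ H¹(K_q, T̄)⁻`, H.4 for `F̄_k(n)`, and the
# isotropy of `loc_q H¹_{F̄_k^q(n)}(K, T̄)` — the letters `horth`, `hiso` at the RESIDUAL level (proofs file, R5 part 2)

Topic `NumberTheory/GaloisCohomology/Howard2004` (companion of `ResidualLocalPairingLettersProofs` — `hnd`, `hf`, `ht` and the
small residual letters; the two files are import-independent: the five small `T̄`-letters used below are PRIVATE copies, the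
public ones live there).  THEOREMS ONLY: no definition, no named fact, no instance, no notation, no `sorry`.

B. Howard, *The Heegner point Kolyvagin system*, Compositio Math. **140** (2004) = arXiv:1202.6340, Lemma 1.5.3
(p. 10 L10–16: «the eigenspaces `H¹(K_q, T̄)^±` are exact orthogonal complements under the `G_ℚ`-invariant local Tate
pairing»; p. 10 L27–33: «the reciprocity law of class field theory and the isotropy of the local conditions `𝓕(n)`
(by H.4) imply `⟨c_q, c_q⟩_q = ∑_v ⟨c_v, c_v̄⟩_v = 0`») and Lemma 1.5.6 (p. 10 L86–93: «`A ⊂ A^⟂`»).  Setting and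
currency as in `ResidualLocalPairingLettersProofs`: a `DVRSetting S` with `hy : S.SatisfiesH`, level `k`, ANY residual
datum `Dbar` (clauses `hDbar`, `hθ` of `exists_residualDualityDatum` where used), `h : S.cd.σ • q = q`, casts
`(h.symm ▸ ·)`, a Frobenius readout `(exp, lam, Θ̄)` at `p^{k'} ∈ 𝔪^{e_k}` (`ResidualTateDualBijectiveProofs`) and a
family `inv : LocalInvariants K (p^{k'})` — all parameters:

* §3 `residual_horth`, `residual_horth_eigen` — opposite `τ_q`-eigenclasses are `⟨ , ⟩_q`-orthogonal
  (`localCup_transportH1_cast_eq_zero_of_eq_of_eq_neg_of_readings` for the Frobenius-form readings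
  `ι_b := inv_· ∘ H²(exp ∘ λ_b)`, `b ∈ R_k`, which separate `H²(K_q, R̄(1))` by `residual_hdet`; the ONE datum letter kept
  is the `G_ℚ`-compatibility `hGQ` of these readings at `q` — for the canonical datum `ConjugationDatum.ofLifts` it is
  `InertLocalPairingOfLiftsProofs.inv_cohomologyMap_cupProduct_thetaH1_transportH1_ofLifts` with `lam := λ_b`).
* §4 `isSelfOrthogonal_residualStructure_modify` — H.4 for `F̄_k(n) = F̄_k.modify 𝒯̄ ∅ ∅ n`, `n ⊆ levelPrimes k`, under
  `p ∤ #𝓞_K^×` (R2 off `n`; `isSelfOrthogonalAt_of_transverse` at `T̄` on `n` with the unit-index count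
  `natCard_transverseStructure_mul_eq_of_isDegreeTwo_of_not_dvd_card_units`); `residual_hiso` — `loc_q H¹_{F̄_k^q(n)}(K, T̄)`
  is isotropic (`RelaxedSelmerIsotropyProofs` for every reading `λ_b`, then `inv_q` injective and `residual_hdet`;
  `inv.SumLocalTermEqZero` = reciprocity).

Cell `pub/bsd-print-x9`, G87 = Howard Thm. 1.6.1 (print leaf `stub_h161` of stmt-BirchSwinnertonDyer-22642); seat
`bsd-line-x10b-p2` g15, brick (GD-LINE-S) part R5 (RES-ORTH/ND/ISO); consumer: R7 (`DVRSettingEngineGDLineProofs`, letters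
`horth`, `hiso`).  HONEST FRAMING: `thm161_dvrKolyvaginBound` is NOT proved here; no summit statement is proved; the
Birch–Swinnerton-Dyer conjecture is not proved by any of this.

References: [Howard2004HeegnerKolyvagin] Lemma 1.5.3, Lemma 1.5.6, Prop. 1.1.9, §1.3 H.4/H.5; [MilneADT2006] I Cor. 2.3,
I Thm. 4.10; [SerreGaloisCohomology1997] II §5.2.
-/

set_option autoImplicit false

noncomputable section

open Function NumberField IsDedekindDomain Field CategoryTheory
open scoped NumberField ContRepresentation

namespace Literature.NumberTheory.GaloisCohomology.Howard2004

open Literature.NumberTheory.GaloisRepresentations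
open Literature.NumberTheory.GaloisRepresentations.DiscreteGaloisModule
open Literature.RingTheory.CompleteLocalRings

namespace DVRSetting

variable {p : ℕ} [Fact p.Prime] {K : Type} [Field K] [NumberField K]
  {R : Type} [CommRing R] [IsDomain R] [IsDiscreteValuationRing R] [Algebra ℤ_[p] R]
  {N : ℕ → Type} [∀ k, AddCommGroup (N k)] [∀ k, TopologicalSpace (N k)]
  [∀ k, DiscreteTopology (N k)] [∀ k, Module R (N k)]
  {Rk : ℕ → Type} [∀ k, CommRing (Rk k)] [∀ k, IsLocalRing (Rk k)] [∀ k, TopologicalSpace (Rk k)]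
  [∀ k, DiscreteTopology (Rk k)] [∀ k, Algebra ℤ_[p] (Rk k)] [∀ k, Algebra R (Rk k)]
  [∀ k, Module (Rk k) (N k)] [∀ k, IsScalarTower R (Rk k) (N k)]
  {Nbar : Type} [AddCommGroup Nbar] [TopologicalSpace Nbar] [DiscreteTopology Nbar]
  [∀ k, Module (Rk k) Nbar]
  {Nq : ℕ → Finset (HeightOneSpectrum (𝓞 K)) → Type} [∀ k n, AddCommGroup (Nq k n)]
  [∀ k n, TopologicalSpace (Nq k n)] [∀ k n, DiscreteTopology (Nq k n)]
  [∀ k n, Module (Rk k) (Nq k n)] [∀ k n, Module R (Nq k n)]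
  [∀ k n, IsScalarTower R (Rk k) (Nq k n)]

/-! ## §0 Small residual letters (private copies of `ResidualLocalPairingLettersProofs` §0) -/

/-- `p^{k'} · T̄ = 0` for `p^{k'} ∈ 𝔪^{e_k}` (`T̄` is an `R_k`-module and `p^{k'} R_k = 0`).
[cite: Howard2004HeegnerKolyvagin, §1.3 H.1 and §1.6 (arXiv:1202.6340 p. 7 L59, p. 11 L33–34)] -/
private theorem pow_natCast_nsmul_residual_eq_zero (S : DVRSetting p K R N Rk Nbar Nq) (hy : S.SatisfiesH) (k : ℕ)
    {k' : ℕ} (hk' : ((p : ℕ) : R) ^ k' ∈ IsLocalRing.maximalIdeal R ^ S.e k) (m : Nbar) :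
    (p ^ k') • m = 0 := by
  have h := S.natCast_pow_smul_levelRing_eq_zero hy k hk' (1 : Rk k)
  rw [← Nat.cast_smul_eq_nsmul (Rk k), ← mul_one ((p ^ k' : ℕ) : Rk k), ← smul_eq_mul,
    Nat.cast_smul_eq_nsmul, h, zero_smul]

/-- `T̄` is `p`-primary: `p · x = 0` for `x ∈ T̄`. [cite: Howard2004HeegnerKolyvagin, §1.3 H.1 (arXiv:1202.6340 p. 7 L59)] -/
private theorem exists_pow_nsmul_residual_eq_zero (S : DVRSetting p K R N Rk Nbar Nq) (hy : S.SatisfiesH) (x : Nbar) :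
    ∃ m : ℕ, p ^ m • x = 0 :=
  ⟨1, by rw [pow_one]; exact S.p_nsmul_residual_eq_zero hy x⟩

/-- `(ℓ + 1) · T̄ = 0` at a prime `q ∈ levelPrimes k` of residue characteristic `ℓ` (through `π̄_k : T^{(k)} ↠ T̄`).
[cite: Howard2004HeegnerKolyvagin, Def. 1.2.1 and §1.6 (arXiv:1202.6340 p. 6 L60–68, p. 11 L36–38)] -/
private theorem residueChar_succ_nsmul_residual_eq_zero (S : DVRSetting p K R N Rk Nbar Nq) (hy : S.SatisfiesH) (k : ℕ)
    {q : HeightOneSpectrum (𝓞 K)} (hq : q ∈ S.levelPrimes k) (x : Nbar) :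
    (residueChar q + 1) • x = 0 := by
  obtain ⟨y, rfl⟩ := (hy.h1 k).1.surjective x
  rw [← map_nsmul, S.residueChar_succ_smul_eq_zero_of_mem_levelPrimes hy hq y, map_zero]

/-- Trivial action of `Γ_{K_{σ q}}` on `T̄` at `q ∈ levelPrimes k` with `σ q = q` (the `htriv'` letter).
[cite: Howard2004HeegnerKolyvagin, Def. 1.2.1 and §1.3 (arXiv:1202.6340 p. 6 L60–68, p. 7 L44–48)] -/
private theorem toLocal_sigma_smul_ρbar_apply_eq_self (S : DVRSetting p K R N Rk Nbar Nq) (hy : S.SatisfiesH) (k : ℕ)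
    {q : HeightOneSpectrum (𝓞 K)} (hq : q ∈ S.levelPrimes k) (h : S.cd.σ • q = q)
    (g : absoluteGaloisGroup ((S.cd.σ • q).adicCompletion K)) (x : Nbar) :
    GaloisRep.toLocal (S.cd.σ • q) S.ρbar g x = x := by
  have hsub : (↑({q} : Finset (HeightOneSpectrum (𝓞 K))) : Set (HeightOneSpectrum (𝓞 K))) ⊆ S.levelPrimes k := by
    rw [Finset.coe_singleton, Set.singleton_subset_iff]; exact hq
  have hmem : S.cd.σ • q ∈ ({q} : Finset (HeightOneSpectrum (𝓞 K))) := by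
    rw [h]; exact Finset.mem_singleton_self q
  exact S.toLocal_ρbar_apply_eq_self_of_subset_levelPrimes hy hsub hmem g x

/-- Trivial action of `Γ_{K_q}` on `T̄` at `q ∈ levelPrimes k` (the `htriv` letter, LEAD's
`toLocal_ρbar_apply_eq_self_of_subset_levelPrimes` at `n = {q}`).
[cite: Howard2004HeegnerKolyvagin, Def. 1.2.1 and H.1 (arXiv:1202.6340 p. 6 L60–68, p. 7 L59)] -/
private theorem toLocal_ρbar_apply_eq_self_of_mem_levelPrimes (S : DVRSetting p K R N Rk Nbar Nq) (hy : S.SatisfiesH)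
    (k : ℕ) {q : HeightOneSpectrum (𝓞 K)} (hq : q ∈ S.levelPrimes k)
    (g : absoluteGaloisGroup (q.adicCompletion K)) (x : Nbar) :
    GaloisRep.toLocal q S.ρbar g x = x := by
  have hsub : (↑({q} : Finset (HeightOneSpectrum (𝓞 K))) : Set (HeightOneSpectrum (𝓞 K))) ⊆ S.levelPrimes k := by
    rw [Finset.coe_singleton, Set.singleton_subset_iff]; exact hq
  exact S.toLocal_ρbar_apply_eq_self_of_subset_levelPrimes hy hsub (Finset.mem_singleton_self q) g x

/-! ## §3 (horth): opposite `τ_q`-eigenclasses are `⟨ , ⟩_q`-orthogonal -/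

/-- **(horth) at the residual level — `H¹(K_q, T̄)⁺ ⊥ H¹(K_q, T̄)⁻` for `⟨ , ⟩_q`.**  For any residual datum `Dbar`
with the H.5(c) letter `hθ` (`exists_residualDualityDatum`, third clause), a Frobenius readout `(exp, lam)` at a level
`p^{k'} ∈ 𝔪^{e_k}` (`exists_residual_toTateDual_bijective`: `r ↦ λ(r·)` bijective), a family `inv` with
`inv.IsPerfect`, at `q` with `σ q = q`: the readings `ι_b := inv_· ∘ H²(exp ∘ λ_b)` (`b ∈ R_k`) have the
`2`-torsion-free target `ℤ/p^{k'}` and separate `H²(K_q, R̄(1))` (`residual_hdet` + `inv_q` injective), so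
`localCup_transportH1_cast_eq_zero_of_eq_of_eq_neg_of_readings` gives `⟨x, y⟩_q = 0 = ⟨y, x⟩_q` whenever
`τ_q x = x`, `τ_q y = −y` — VERBATIM the binder `horth` of `DualityDatum.length_map_inf_eigen_eq_one`.  The ONE letter
kept is the `G_ℚ`-compatibility `hGQ` of the readings at `q` (for `S.cd = ConjugationDatum.ofLifts …` and a
`σ`-compatible family `inv` it is `inv_cohomologyMap_cupProduct_thetaH1_transportH1_ofLifts` with `lam := λ_b`).
[cite: Howard2004HeegnerKolyvagin, Lemma 1.5.3 (arXiv:1202.6340 p. 10 L10–16: «exact orthogonal complements under the `G_ℚ`-invariant local Tate pairing»)] [cite: MilneADT2006, Ch. I Cor. 2.3] -/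
theorem residual_horth [Finite Nbar] (S : DVRSetting p K R N Rk Nbar Nq) (hy : S.SatisfiesH) (k : ℕ) {k' : ℕ}
    (hk' : ((p : ℕ) : R) ^ k' ∈ IsLocalRing.maximalIdeal R ^ S.e k)
    (exp : ZMod (p ^ k') →+ MuCarrier K (p ^ k'))
    (hexp : ∀ (g : absoluteGaloisGroup K) (x : ZMod (p ^ k')),
      exp (cyclotomicCharacterModPow K p k' g * x) = mu K (p ^ k') g (exp x))
    (hexpb : Bijective exp) (Dbar : DualityDatum p S.cd S.ρbar (Rk k))
    (hθ : ∀ x y : Nbar, Dbar.e ((S.A k).θ x) ((S.A k).θ y) = -Dbar.e x y)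
    (lam : Rk k →+ ZMod (p ^ k'))
    (hlam : ∀ (z : ℤ_[p]) (a : Rk k), lam (algebraMap ℤ_[p] (Rk k) z * a) = PadicInt.toZModPow k' z * lam a)
    (hfrob : Bijective ((AddMonoidHom.mul : Rk k →+ Rk k →+ Rk k).compr₂ lam))
    (inv : LocalInvariants K (p ^ k')) (hperf : inv.IsPerfect)
    {q : HeightOneSpectrum (𝓞 K)} (h : S.cd.σ • q = q)
    (hGQ : ∀ (b : Rk k) (x y : galoisCohomology (S.ρbar.toLocal (Sum.inr (S.cd.σ • q))) 1),
      inv (Sum.inr q) (cohomologyMap (Dbar.expLamLocalHom (DualityDatum.lamMul lam b)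
          (DualityDatum.lamMul_semilinear lam hlam b) exp hexp (Sum.inr q)) 2
        (haveI : CompactSpace (absoluteGaloisGroup (Place.Completion (Sum.inr q : Place K))) :=
            absoluteGaloisGroup_compactSpace _;
          (DiscreteGaloisModule.pairing (S.ρbar.toLocal (Sum.inr q)) (S.ρbar.toLocal (Sum.inr q))
              (Dbar.twistOne.toLocal (Sum.inr q)) (Dbar.eHom.compl₂ (S.A k).θ.toAddMonoidHom)
              (Dbar.thetaPairing_equivariant_toLocal (S.A k) (Sum.inr q))).cupProduct
            ((S.A k).thetaH1 (Sum.inr q) (S.cd.transportH1 S.ρbar q x))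
            ((S.A k).thetaH1 (Sum.inr q) (S.cd.transportH1 S.ρbar q y)))) =
      inv (Sum.inr (S.cd.σ • q)) (cohomologyMap (Dbar.expLamLocalHom (DualityDatum.lamMul lam b)
          (DualityDatum.lamMul_semilinear lam hlam b) exp hexp (Sum.inr (S.cd.σ • q))) 2
        (haveI : CompactSpace (absoluteGaloisGroup (Place.Completion (Sum.inr (S.cd.σ • q) : Place K))) :=
            absoluteGaloisGroup_compactSpace _;
          (DiscreteGaloisModule.pairing (S.ρbar.toLocal (Sum.inr (S.cd.σ • q)))
              (S.ρbar.toLocal (Sum.inr (S.cd.σ • q))) (Dbar.twistOne.toLocal (Sum.inr (S.cd.σ • q)))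
              (Dbar.eHom.compl₂ (S.A k).θ.toAddMonoidHom)
              (Dbar.thetaPairing_equivariant_toLocal (S.A k) (Sum.inr (S.cd.σ • q)))).cupProduct x y))) :
    ∀ x y : galoisCohomology (S.ρbar.toLocal (Sum.inr q)) 1,
      (S.A k).thetaH1 (Sum.inr q) (S.cd.transportH1 S.ρbar q
          (h.symm ▸ x : galoisCohomology (S.ρbar.toLocal (Sum.inr (S.cd.σ • q))) 1)) = x →
      (S.A k).thetaH1 (Sum.inr q) (S.cd.transportH1 S.ρbar q
          (h.symm ▸ y : galoisCohomology (S.ρbar.toLocal (Sum.inr (S.cd.σ • q))) 1)) = -y →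
      Dbar.localCup (Sum.inr q) x (S.cd.transportH1 S.ρbar q
          (h.symm ▸ y : galoisCohomology (S.ρbar.toLocal (Sum.inr (S.cd.σ • q))) 1)) = 0 ∧
        Dbar.localCup (Sum.inr q) y (S.cd.transportH1 S.ρbar q
          (h.symm ▸ x : galoisCohomology (S.ρbar.toLocal (Sum.inr (S.cd.σ • q))) 1)) = 0 := by
  have hp : p.Prime := Fact.out
  intro x y hx hy'
  -- the Frobenius-form readings `ι_b := inv ∘ H²(exp ∘ λ_b)`
  let ι : Rk k → (w : HeightOneSpectrum (𝓞 K)) →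
      galoisCohomology (Dbar.twistOne.toLocal (Sum.inr w)) 2 →+ ZMod (p ^ k') := fun b w =>
    AddMonoidHom.mk' (fun z => inv (Sum.inr w) (cohomologyMap (Dbar.expLamLocalHom (DualityDatum.lamMul lam b)
      (DualityDatum.lamMul_semilinear lam hlam b) exp hexp (Sum.inr w)) 2 z)) (fun z z' =>
        (congrArg (inv (Sum.inr w)) (map_add _ z z')).trans (map_add (inv (Sum.inr w)) _ _))
  have hι : ∀ b w z, ι b w z = inv (Sum.inr w) (cohomologyMap (Dbar.expLamLocalHom (DualityDatum.lamMul lam b)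
      (DualityDatum.lamMul_semilinear lam hlam b) exp hexp (Sum.inr w)) 2 z) := fun _ _ _ => rfl
  -- `ℤ/p^{k'}` has no `2`-torsion (`p` odd)
  have h2 : ∀ z : ZMod (p ^ k'), 2 • z = 0 → z = 0 := fun z hz => by
    have hu : IsUnit ((2 : ℕ) : ZMod (p ^ k')) :=
      (ZMod.isUnit_iff_coprime 2 (p ^ k')).2
        (((Nat.coprime_primes Nat.prime_two hp).2 (Ne.symm hy.p_odd)).pow_right k')
    rw [nsmul_eq_mul] at hz
    exact hu.mul_right_eq_zero.1 hz
  -- the readings separate `H²(K_q, R̄(1))`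
  have hread : ∀ z : galoisCohomology (Dbar.twistOne.toLocal (Sum.inr q)) 2, (∀ b, ι b q z = 0) → z = 0 :=
    fun z hz => S.residual_hdet hy k hk' exp hexp hexpb Dbar lam hlam hfrob (Sum.inr q) z fun b =>
      (hperf q).1.1 (((hι b q z).symm.trans (hz b)).trans (map_zero _).symm)
  exact Dbar.localCup_transportH1_cast_eq_zero_of_eq_of_eq_neg_of_readings (S.A k) h hθ ι
    (fun b x' y'' => hGQ b x' y'') h2 hread hx hy'

/-- **(horth) in the (DICH) binder shape**: for a sign `ε = ±1`, any local conditions `Lf, Lt ≤ H¹(K_q, T̄)`,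
`u ∈ Lf` with `τ_q u = ε u` and `w ∈ Lt` with `τ_q w = −ε w`: `⟨u, transport_q w⟩_q = 0` — VERBATIM the binder `horth`
of `DualityDatum.map_inf_le_or_le_of_isotropic_of_eigen`, from `residual_horth` (for `ε = −1` with the roles of the
two classes exchanged). [cite: Howard2004HeegnerKolyvagin, Lemma 1.5.3 (arXiv:1202.6340 p. 10 L10–16, L34–40)] -/
theorem residual_horth_eigen [Finite Nbar] (S : DVRSetting p K R N Rk Nbar Nq) (hy : S.SatisfiesH) (k : ℕ)
    {k' : ℕ} (hk' : ((p : ℕ) : R) ^ k' ∈ IsLocalRing.maximalIdeal R ^ S.e k)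
    (exp : ZMod (p ^ k') →+ MuCarrier K (p ^ k'))
    (hexp : ∀ (g : absoluteGaloisGroup K) (x : ZMod (p ^ k')),
      exp (cyclotomicCharacterModPow K p k' g * x) = mu K (p ^ k') g (exp x))
    (hexpb : Bijective exp) (Dbar : DualityDatum p S.cd S.ρbar (Rk k))
    (hθ : ∀ x y : Nbar, Dbar.e ((S.A k).θ x) ((S.A k).θ y) = -Dbar.e x y)
    (lam : Rk k →+ ZMod (p ^ k'))
    (hlam : ∀ (z : ℤ_[p]) (a : Rk k), lam (algebraMap ℤ_[p] (Rk k) z * a) = PadicInt.toZModPow k' z * lam a)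
    (hfrob : Bijective ((AddMonoidHom.mul : Rk k →+ Rk k →+ Rk k).compr₂ lam))
    (inv : LocalInvariants K (p ^ k')) (hperf : inv.IsPerfect)
    {q : HeightOneSpectrum (𝓞 K)} (h : S.cd.σ • q = q)
    (hGQ : ∀ (b : Rk k) (x y : galoisCohomology (S.ρbar.toLocal (Sum.inr (S.cd.σ • q))) 1),
      inv (Sum.inr q) (cohomologyMap (Dbar.expLamLocalHom (DualityDatum.lamMul lam b)
          (DualityDatum.lamMul_semilinear lam hlam b) exp hexp (Sum.inr q)) 2
        (haveI : CompactSpace (absoluteGaloisGroup (Place.Completion (Sum.inr q : Place K))) :=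
            absoluteGaloisGroup_compactSpace _;
          (DiscreteGaloisModule.pairing (S.ρbar.toLocal (Sum.inr q)) (S.ρbar.toLocal (Sum.inr q))
              (Dbar.twistOne.toLocal (Sum.inr q)) (Dbar.eHom.compl₂ (S.A k).θ.toAddMonoidHom)
              (Dbar.thetaPairing_equivariant_toLocal (S.A k) (Sum.inr q))).cupProduct
            ((S.A k).thetaH1 (Sum.inr q) (S.cd.transportH1 S.ρbar q x))
            ((S.A k).thetaH1 (Sum.inr q) (S.cd.transportH1 S.ρbar q y)))) =
      inv (Sum.inr (S.cd.σ • q)) (cohomologyMap (Dbar.expLamLocalHom (DualityDatum.lamMul lam b)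
          (DualityDatum.lamMul_semilinear lam hlam b) exp hexp (Sum.inr (S.cd.σ • q))) 2
        (haveI : CompactSpace (absoluteGaloisGroup (Place.Completion (Sum.inr (S.cd.σ • q) : Place K))) :=
            absoluteGaloisGroup_compactSpace _;
          (DiscreteGaloisModule.pairing (S.ρbar.toLocal (Sum.inr (S.cd.σ • q)))
              (S.ρbar.toLocal (Sum.inr (S.cd.σ • q))) (Dbar.twistOne.toLocal (Sum.inr (S.cd.σ • q)))
              (Dbar.eHom.compl₂ (S.A k).θ.toAddMonoidHom)
              (Dbar.thetaPairing_equivariant_toLocal (S.A k) (Sum.inr (S.cd.σ • q)))).cupProduct x y)))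
    {ε : ℤ} (hε : ε = 1 ∨ ε = -1) (Lf Lt : AddSubgroup (galoisCohomology (S.ρbar.toLocal (Sum.inr q)) 1)) :
    ∀ u ∈ Lf, ∀ w ∈ Lt,
      (S.A k).thetaH1 (Sum.inr q) (S.cd.transportH1 S.ρbar q
          (h.symm ▸ u : galoisCohomology (S.ρbar.toLocal (Sum.inr (S.cd.σ • q))) 1)) = ε • u →
        (S.A k).thetaH1 (Sum.inr q) (S.cd.transportH1 S.ρbar q
          (h.symm ▸ w : galoisCohomology (S.ρbar.toLocal (Sum.inr (S.cd.σ • q))) 1)) = -(ε • w) →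
        Dbar.localCup (Sum.inr q) u (S.cd.transportH1 S.ρbar q
          (h.symm ▸ w : galoisCohomology (S.ρbar.toLocal (Sum.inr (S.cd.σ • q))) 1)) = 0 := by
  intro u _ w _ hu hw
  have H := S.residual_horth hy k hk' exp hexp hexpb Dbar hθ lam hlam hfrob inv hperf h hGQ
  rcases hε with rfl | rfl
  · rw [one_zsmul] at hu hw
    exact (H u w hu hw).1
  · rw [neg_one_zsmul] at hu hw
    rw [neg_neg] at hw
    exact (H w u hw hu).2

/-! ## §4 (hiso): H.4 for `F̄_k(n)` and the isotropy of `loc_q H¹_{F̄_k^q(n)}(K, T̄)` -/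

/-- **H.4 for the modified residual structure `F̄_k(n) = F̄_k.modify 𝒯̄ ∅ ∅ n`** (`n ⊆ levelPrimes k`) at EVERY finite
place, for any residual datum with the clause `hDbar` and `Θ̄` bijective: off `n` it is R2's
`isSelfOrthogonal_residualStructure` (`isSelfOrthogonal_of_eq_off`, `n` is `σ`-stable), on `n` the transverse condition
is its own exact orthogonal complement (`isSelfOrthogonalAt_of_transverse` at `T̄`: isotropy of `H¹_tr(K_v, T̄)` and the
count `#H¹_tr(K_v, T̄)·#H¹_tr(K_v̄, T̄) = #H¹(K_v, T̄)`, `natCard_transverseStructure_mul_eq_of_isDegreeTwo`, with the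
residual local letters of §0 and `d_K < -4`).
[cite: Howard2004HeegnerKolyvagin, §1.3 H.4 for `𝓕(n)` (arXiv:1202.6340 p. 7 L69–82), Prop. 1.1.9, Lemma 1.5.6 (p. 10 L86–88)] [cite: MilneADT2006, Ch. I Cor. 2.3] -/
theorem isSelfOrthogonal_residualStructure_modify [Finite Nbar] (S : DVRSetting p K R N Rk Nbar Nq)
    (hy : S.SatisfiesH) (hu : ¬ p ∣ Nat.card (𝓞 K)ˣ) (k : ℕ) {k' : ℕ}
    (hk' : ((p : ℕ) : R) ^ k' ∈ IsLocalRing.maximalIdeal R ^ S.e k)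
    (exp : ZMod (p ^ k') →+ MuCarrier K (p ^ k'))
    (hexp : ∀ (g : absoluteGaloisGroup K) (x : ZMod (p ^ k')),
      exp (cyclotomicCharacterModPow K p k' g * x) = mu K (p ^ k') g (exp x))
    (Dbar : DualityDatum p S.cd S.ρbar (Rk k))
    (hDbar : ∀ s t : N k, Dbar.e (S.πbar k s) (S.πbar k t) =
      algebraMap R (Rk k) S.π ^ (S.e k - 1) * (S.D k).e s t)
    (lam : Rk k →+ ZMod (p ^ k'))
    (hlam : ∀ (z : ℤ_[p]) (a : Rk k), lam (algebraMap ℤ_[p] (Rk k) z * a) = PadicInt.toZModPow k' z * lam a)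
    (hΘ : Bijective (Dbar.toTateDual lam hlam exp hexp))
    (inv : LocalInvariants K (p ^ k')) (hperf : inv.IsPerfect)
    {n : Finset (HeightOneSpectrum (𝓞 K))} (hn : ↑n ⊆ S.levelPrimes k) :
    Dbar.IsSelfOrthogonal
      (((hy.h1 k).1.propagateStructure (S.t k).cond).modify (transverseStructure p S.ρbar S.jbar) ∅ ∅ n) := by
  haveI : Finite (Rk k) := S.finite_coeffLevel hy k
  have hp : p.Prime := Fact.out
  have hRk : ∀ r : Rk k, p ^ S.e k • r = 0 :=
    S.natCast_pow_smul_levelRing_eq_zero hy k (S.natCast_pow_mem_maximalIdeal_pow_of_le hy le_rfl)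
  have hodd : Odd (p ^ S.e k) := (hp.odd_of_ne_two hy.p_odd).pow
  refine Dbar.isSelfOrthogonal_of_eq_off ((hy.h1 k).1.propagateStructure (S.t k).cond) _
    (↑n : Set (HeightOneSpectrum (𝓞 K))) (fun v hv => ?_) (fun v hv => ?_)
    (S.isSelfOrthogonal_residualStructure hy k Dbar hDbar) (fun v hv => ?_)
  · rw [Finset.mem_coe] at hv ⊢
    rw [S.sigma_smul_eq_self_of_mem_L hy (hn hv).1]; exact hv
  · rw [Finset.mem_coe] at hv
    exact SelmerStructure.modify_inr_of_not_mem _ _ (Finset.notMem_empty _) (Finset.notMem_empty _) hv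
  · rw [Finset.mem_coe] at hv
    have hvlev : v ∈ S.levelPrimes k := hn hv
    have hfix : S.cd.σ • v = v := S.sigma_smul_eq_self_of_mem_L hy hvlev.1
    have hℓ0 : residueChar v ≠ 0 := (prime_residueChar v).ne_zero
    have h𝓖v : ((hy.h1 k).1.propagateStructure (S.t k).cond).modify (transverseStructure p S.ρbar S.jbar) ∅ ∅ n
        (Sum.inr v) = transverseStructure p S.ρbar S.jbar (Sum.inr v) :=
      SelmerStructure.modify_inr_of_mem_transverse _ _ (Finset.notMem_empty _) (Finset.notMem_empty _) hv
    obtain ⟨σ₀, -, hcyc⟩ := exists_forall_pow_inv_mul_mem_localRingClassSubgroup_of_isDegreeTwo' hy.imagQuad S.jbar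
      (S.isDegreeTwo_of_mem_L hy hvlev.1)
    have htriv := S.toLocal_ρbar_apply_eq_self_of_mem_levelPrimes hy k hvlev
    have htriv' := S.toLocal_sigma_smul_ρbar_apply_eq_self hy k hvlev hfix
    refine Dbar.isSelfOrthogonalAt_of_transverse lam hlam exp hexp (S.pow_natCast_nsmul_residual_eq_zero hy k hk')
      hΘ inv hperf (residueChar v) S.jbar v _ (by rw [h𝓖v, transverseStructure_inr]; rfl)
      (by rw [hfix, h𝓖v, transverseStructure_inr]; rfl) htriv htriv'
      (S.cd.toLocal_twist_apply_eq_self S.ρbar v htriv') (S.exists_pow_nsmul_residual_eq_zero hy) hodd hRk σ₀ hcyc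
      (fun g hg => S.cd.φ_mem_localRingClassSubgroup hy.imagQuad S.jbar hℓ0 v hg) ?_
    rw [hfix, h𝓖v]
    exact natCard_transverseStructure_mul_eq_of_isDegreeTwo_of_not_dvd_card_units p hy.imagQuad hu S.ρbar S.jbar
      (S.isDegreeTwo_of_mem_L hy hvlev.1) rfl htriv htriv (S.exists_pow_nsmul_residual_eq_zero hy)
      (S.residueChar_succ_nsmul_residual_eq_zero hy k hvlev)

/-- **(hiso) at the residual level: `loc_q H¹_{F̄_k^q(n)}(K, T̄)` is isotropic for `⟨ , ⟩_q`** (`n ⊆ levelPrimes k`,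
`σ q = q`, any residual datum with `hDbar`, a Frobenius readout with `Θ̄` bijective, a family `inv` with local duality
`IsPerfect` and reciprocity `SumLocalTermEqZero`): for `c, d ∈ H¹_{F̄_k^q(n)}(K, T̄)`,
`⟨loc_q c, transport_q loc_q d⟩_q = 0` — VERBATIM the binder `hiso` of `DualityDatum.length_map_inf_eigen_eq_one` /
`map_inf_le_or_le_of_isotropic_of_eigen` with `S := (F̄_k.modify 𝒯̄ {q} ∅ n).selmerGroup`.  Proof: for every reading
`λ_b`, `inv_q (H²(exp ∘ λ_b) ⟨c_q, d_q̄⟩_q) = −∑_{v ≠ q} (…) = 0` by reciprocity and H.4 for `F̄_k(n)` off `q`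
(`RelaxedSelmerIsotropyProofs`), then `inv_q` injective and `residual_hdet`.
[cite: Howard2004HeegnerKolyvagin, Lemma 1.5.3 (b) (arXiv:1202.6340 p. 10 L27–33) and Lemma 1.5.6 (p. 10 L86–93: «`A ⊂ A^⟂`»)] [cite: MilneADT2006, Ch. I Thm. 4.10] -/
theorem residual_hiso [Finite Nbar] (S : DVRSetting p K R N Rk Nbar Nq) (hy : S.SatisfiesH)
    (hu : ¬ p ∣ Nat.card (𝓞 K)ˣ) (k : ℕ) {k' : ℕ}
    (hk' : ((p : ℕ) : R) ^ k' ∈ IsLocalRing.maximalIdeal R ^ S.e k)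
    (exp : ZMod (p ^ k') →+ MuCarrier K (p ^ k'))
    (hexp : ∀ (g : absoluteGaloisGroup K) (x : ZMod (p ^ k')),
      exp (cyclotomicCharacterModPow K p k' g * x) = mu K (p ^ k') g (exp x))
    (hexpb : Bijective exp) (Dbar : DualityDatum p S.cd S.ρbar (Rk k))
    (hDbar : ∀ s t : N k, Dbar.e (S.πbar k s) (S.πbar k t) =
      algebraMap R (Rk k) S.π ^ (S.e k - 1) * (S.D k).e s t)
    (lam : Rk k →+ ZMod (p ^ k'))
    (hlam : ∀ (z : ℤ_[p]) (a : Rk k), lam (algebraMap ℤ_[p] (Rk k) z * a) = PadicInt.toZModPow k' z * lam a)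
    (hfrob : Bijective ((AddMonoidHom.mul : Rk k →+ Rk k →+ Rk k).compr₂ lam))
    (hΘ : Bijective (Dbar.toTateDual lam hlam exp hexp))
    (inv : LocalInvariants K (p ^ k')) (hperf : inv.IsPerfect) (hPT : inv.SumLocalTermEqZero)
    {n : Finset (HeightOneSpectrum (𝓞 K))} (hn : ↑n ⊆ S.levelPrimes k)
    {q : HeightOneSpectrum (𝓞 K)} (h : S.cd.σ • q = q) :
    ∀ c ∈ (((hy.h1 k).1.propagateStructure (S.t k).cond).modify (transverseStructure p S.ρbar S.jbar)
        {q} ∅ n).selmerGroup,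
      ∀ d ∈ (((hy.h1 k).1.propagateStructure (S.t k).cond).modify (transverseStructure p S.ρbar S.jbar)
        {q} ∅ n).selmerGroup,
      Dbar.localCup (Sum.inr q) (galoisCohomology.localization S.ρbar (Sum.inr q) 1 c)
        (S.cd.transportH1 S.ρbar q (h.symm ▸ galoisCohomology.localization S.ρbar (Sum.inr q) 1 d :
          galoisCohomology (S.ρbar.toLocal (Sum.inr (S.cd.σ • q))) 1)) = 0 := by
  intro c hc d hdm
  rw [cast_localization S.ρbar h.symm d]
  have hso := S.isSelfOrthogonal_residualStructure_modify hy hu k hk' exp hexp Dbar hDbar lam hlam hΘ inv hperf hn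
  have hoff : ∀ v : HeightOneSpectrum (𝓞 K), v ≠ q →
      ((hy.h1 k).1.propagateStructure (S.t k).cond).modify (transverseStructure p S.ρbar S.jbar) {q} ∅ n (Sum.inr v) =
        ((hy.h1 k).1.propagateStructure (S.t k).cond).modify (transverseStructure p S.ρbar S.jbar) ∅ ∅ n
          (Sum.inr v) := fun v hv =>
    (SelmerStructure.modify_level_eq_relaxed_of_ne _ _ q n (Sum.inr v) (fun e => hv (Sum.inr_injective e))).symm
  have hinf : ∀ (w : InfinitePlace K) (x : galoisCohomology S.ρbar 1),
      galoisCohomology.localization S.ρbar (Sum.inl w) 1 x = 0 := fun w x =>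
    S.galoisCohomology_rhobar_toLocal_inl_eq_zero hy w _
  refine S.residual_hdet hy k hk' exp hexp hexpb Dbar lam hlam hfrob (Sum.inr q) _ fun b => ?_
  exact (hperf q).1.1 ((Dbar.inv_cohomologyMap_localCup_transportH1_eq_zero_of_isotropic_of_mem_selmerGroup
    (DualityDatum.lamMul lam b) (DualityDatum.lamMul_semilinear lam hlam b) exp hexp
    (S.pow_natCast_nsmul_residual_eq_zero hy k hk') inv hPT _ _ h hoff
    (fun v _ x hx y hy'' => ((hso v).1 x).1 hx y hy'') hinf hc hdm).trans (map_zero _).symm)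

end DVRSetting

end Literature.NumberTheory.GaloisCohomology.Howard2004

end
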